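import Summits.AtomisticToContinuum.FouriersLaw.Theorems.HiddenChargeMazurOddChargeExistsStubOverlapDensityLimitWindow
import Summits.AtomisticToContinuum.FouriersLaw.Theorems.HiddenChargeMazurOddChargeExistsStubOverlapDensityLimitCesaro

/-!
# Stub `stub_overlapDensityLimit` of the birth line of crux `OddChargeExists` — PROVED (part 4/4)

`--supports stmt-AtomisticToContinuum-13511` (crux `HiddenChargeMazur.OddChargeExists`, line `registered` =
`Cruxes/OddChargeExists/Lines/birth.lean`); proves the registered stub `stub_overlapDensityLimit` VERBATIM:
for the pinned anharmonic chain `pinnedChain ω₂ lam β γ` (all parameters `> 0`), `T > 0`, every window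
radius `R` and every POLYNOMIAL window density `g` on `2R+1` sites, the current-overlap density
`N⁻¹ ∫ J_N · Q_N d(volume.tilted (-H_N/T))` (`J_N = Σ_i j_i`, `Q_N = Σ_{x<N-2R} g(sites x..x+2R)`) converges
as `N → ∞`.

Proof (assembly of tree results, all `[folklore]`):
* momentum orthogonality (`NoOddCharge.pinnedChain_integral_momentum_mul_eq_zero`): `∫ j_i g_x dμ_N = 0`
  unless the bond `(i, i+1)` touches the window `[x, x+2R]` (`pinnedChain_current_obs_term`, this file), so
  `∫ J_N Q_N dμ_N` is a sum over bulk anchors of the expectation of ONE fixed polynomial window observable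
  `F = (Σ_c j_c) · g` on `2R+3` sites (`window_sum_eq`, part 2), plus two boundary windows;
* `N`-uniform moments of all orders at every site (part 1), whence `N`-uniform bounds `|∫ j_i g_x dμ_N| ≤ C₁`
  on the at most `2R+2` touching terms of the boundary windows;
* the thermodynamic limit of Cesàro window sums (`tendsto_div_of_windowSum`, part 3: truncation, the
  anchor-uniform bulk equivalence of ensembles `stub_bulkWindowEquivalence`, completeness of `ℝ`).

No definitions, no named facts, no `sorry`.
-/

noncomputable section

open MeasureTheory Set Function Finset Filter Topology
open scoped BigOperators

namespace Summit.AtomisticToContinuum.FouriersLaw.Theorems.OddChargeExists.OverlapDensityLimit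

open Literature.MathematicalPhysics.KineticTheory.HeatConduction OscillatorChain
open Summit.AtomisticToContinuum.FouriersLaw.Theorems.LightConeBondHeat
open Summit.AtomisticToContinuum.FouriersLaw.Theorems.NoOddCharge

/-! ### §1 The current–window correlations `∫ j_i g_x dμ_{N,T}`: integrability, uniform bound, orthogonality -/

section Pinned

variable {ω₂ lam β : ℝ}

/-- **The current–observable correlations.** For `R`, `Cg ≥ 0`, `dg` there is `C₁` such that for every
`N`, every bond `i`, every anchor `x`, and every continuous observable `G` dominated by `Cg` times the
`dg`-th power of a `(2R+1)`-site sum and blind to the momenta outside `[x, x+2R]`: `j_i · G` is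
`μ_{N,T}`-integrable, `|∫ j_i G dμ_{N,T}| ≤ C₁` (uniformly: `N`-uniform one-site moments), and
`∫ j_i G dμ_{N,T} = 0` whenever the bond `(i, i+1)` does not touch `[x, x+2R]` (momentum orthogonality: the
momenta are independent centred Gaussians under `e^{-H/T}`). [folklore] -/
theorem pinnedChain_current_obs_term (hω : 0 < ω₂) (hl : 0 < lam) (hβ : 0 < β) (γ : ℝ) {T : ℝ}
    (hT : 0 < T) (R : ℕ) {Cg : ℝ} (hCg : 0 ≤ Cg) (dg : ℕ) :
    ∃ C₁ : ℝ, 0 ≤ C₁ ∧ ∀ (N : ℕ) (i : Fin N) (x : ℕ) (sg : Fin (2 * R + 1) → Fin N) (G : PhaseSpace N → ℝ),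
      Continuous G →
      (∀ z, |G z| ≤ Cg * (1 + ∑ t : Fin (2 * R + 1), (z.1 (sg t) ^ 2 + z.2 (sg t) ^ 2)) ^ dg) →
      (∀ k : Fin N, (k.val < x ∨ x + (2 * R + 1) ≤ k.val) →
        ∀ (z : PhaseSpace N) (t : ℝ), G (z.1, Function.update z.2 k t) = G z) →
      Integrable (fun z : PhaseSpace N => (pinnedChain ω₂ lam β γ).bondCurrent N i z * G z)
        ((pinnedChain ω₂ lam β γ).gibbsMeasure N T) ∧
      |∫ z, (pinnedChain ω₂ lam β γ).bondCurrent N i z * G z ∂((pinnedChain ω₂ lam β γ).gibbsMeasure N T)| ≤ C₁ ∧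
      ((i.val + 1 < x ∨ x + 2 * R < i.val) →
        ∫ z, (pinnedChain ω₂ lam β γ).bondCurrent N i z * G z ∂((pinnedChain ω₂ lam β γ).gibbsMeasure N T) = 0) := by
  obtain ⟨Mo2, hMo2⟩ := pinnedChain_gibbs_siteSum_pow_le hω hl hβ.le γ hT 2 8
  obtain ⟨Mog, hMog⟩ := pinnedChain_gibbs_siteSum_pow_le hω hl hβ.le γ hT (2 * R + 1) (2 * dg)
  refine ⟨(2 + 8 * β) ^ 2 * max Mo2 0 + Cg ^ 2 * max Mog 0, by positivity,
    fun N i x sg G hGc hGb hGinv => ?_⟩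
  haveI : IsProbabilityMeasure ((pinnedChain ω₂ lam β γ).gibbsMeasure N T) :=
    pinnedChain_isProbabilityMeasure_gibbsMeasure hω hl.le hβ.le γ N hT
  have hG2b : ∀ z, |G z ^ 2| ≤ Cg ^ 2 * (1 + ∑ t : Fin (2 * R + 1), (z.1 (sg t) ^ 2 + z.2 (sg t) ^ 2)) ^ (2 * dg) := by
    intro z
    rw [abs_pow, pow_mul', ← mul_pow]
    exact pow_le_pow_left₀ (abs_nonneg _) (hGb z) 2
  have hGi : Integrable G ((pinnedChain ω₂ lam β γ).gibbsMeasure N T) :=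
    pinnedChain_integrable_gibbs_of_le_siteSum hω hl hβ.le γ hT sg hGc hCg dg hGb
  have hG2i : Integrable (fun z => G z ^ 2) ((pinnedChain ω₂ lam β γ).gibbsMeasure N T) :=
    pinnedChain_integrable_gibbs_of_le_siteSum hω hl hβ.le γ hT sg (hGc.pow 2) (by positivity) (2 * dg) hG2b
  have hG2 : ∫ z, G z ^ 2 ∂((pinnedChain ω₂ lam β γ).gibbsMeasure N T) ≤ Cg ^ 2 * max Mog 0 := by
    have h1 := integral_mono hG2i ((hMog N sg).1.const_mul (Cg ^ 2)) fun z => (le_abs_self _).trans (hG2b z)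
    rw [integral_const_mul] at h1
    exact h1.trans (mul_le_mul_of_nonneg_left ((hMog N sg).2.trans (le_max_left _ _)) (sq_nonneg _))
  by_cases hi : i.val + 1 < N
  · -- a genuine bond `(i, i+1)`
    have hjc : Continuous ((pinnedChain ω₂ lam β γ).bondCurrent N i) := pinnedChain_continuous_bondCurrent ω₂ lam β γ N i
    have hjb : ∀ z, |(pinnedChain ω₂ lam β γ).bondCurrent N i z| ≤
        (2 + 8 * β) * (1 + ∑ t : Fin 2, (z.1 (![i, ⟨i.val + 1, hi⟩] t) ^ 2 + z.2 (![i, ⟨i.val + 1, hi⟩] t) ^ 2)) ^ 4 :=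
      fun z => pinnedChain_abs_bondCurrent_le_siteSum hβ.le ω₂ lam γ i hi z
    have hj2b : ∀ z, |(pinnedChain ω₂ lam β γ).bondCurrent N i z ^ 2| ≤
        (2 + 8 * β) ^ 2 * (1 + ∑ t : Fin 2, (z.1 (![i, ⟨i.val + 1, hi⟩] t) ^ 2 + z.2 (![i, ⟨i.val + 1, hi⟩] t) ^ 2)) ^ 8 := by
      intro z
      rw [abs_pow, show (8 : ℕ) = 2 * 4 from rfl, pow_mul', ← mul_pow]
      exact pow_le_pow_left₀ (abs_nonneg _) (hjb z) 2
    have hj2i : Integrable (fun z => (pinnedChain ω₂ lam β γ).bondCurrent N i z ^ 2) ((pinnedChain ω₂ lam β γ).gibbsMeasure N T) :=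
      pinnedChain_integrable_gibbs_of_le_siteSum hω hl hβ.le γ hT _ (hjc.pow 2) (by positivity) 8 hj2b
    have hj2 : ∫ z, (pinnedChain ω₂ lam β γ).bondCurrent N i z ^ 2 ∂((pinnedChain ω₂ lam β γ).gibbsMeasure N T) ≤
        (2 + 8 * β) ^ 2 * max Mo2 0 := by
      have h1 := integral_mono hj2i ((hMo2 N ![i, ⟨i.val + 1, hi⟩]).1.const_mul ((2 + 8 * β) ^ 2))
        fun z => (le_abs_self _).trans (hj2b z)
      rw [integral_const_mul] at h1
      exact h1.trans (mul_le_mul_of_nonneg_left ((hMo2 N _).2.trans (le_max_left _ _)) (sq_nonneg _))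
    have hdom : ∀ z, |(pinnedChain ω₂ lam β γ).bondCurrent N i z * G z| ≤
        (pinnedChain ω₂ lam β γ).bondCurrent N i z ^ 2 + G z ^ 2 := fun z => by
      rw [abs_mul]
      nlinarith [sq_nonneg (|(pinnedChain ω₂ lam β γ).bondCurrent N i z| - |G z|),
        sq_abs ((pinnedChain ω₂ lam β γ).bondCurrent N i z), sq_abs (G z),
        abs_nonneg ((pinnedChain ω₂ lam β γ).bondCurrent N i z), abs_nonneg (G z)]
    have hsqi : Integrable (fun z => (pinnedChain ω₂ lam β γ).bondCurrent N i z ^ 2 + G z ^ 2)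
        ((pinnedChain ω₂ lam β γ).gibbsMeasure N T) := hj2i.add hG2i
    have hprodm : AEStronglyMeasurable (fun z => (pinnedChain ω₂ lam β γ).bondCurrent N i z * G z)
        ((pinnedChain ω₂ lam β γ).gibbsMeasure N T) := (hjc.mul hGc).aestronglyMeasurable
    have hprodi : Integrable (fun z => (pinnedChain ω₂ lam β γ).bondCurrent N i z * G z)
        ((pinnedChain ω₂ lam β γ).gibbsMeasure N T) :=
      hsqi.mono' hprodm (Eventually.of_forall fun z => by rw [Real.norm_eq_abs]; exact hdom z)
    refine ⟨hprodi, ?_, fun hfar => ?_⟩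
    · have hstep1 : |∫ z, (pinnedChain ω₂ lam β γ).bondCurrent N i z * G z ∂((pinnedChain ω₂ lam β γ).gibbsMeasure N T)| ≤
          ∫ z, |(pinnedChain ω₂ lam β γ).bondCurrent N i z * G z| ∂((pinnedChain ω₂ lam β γ).gibbsMeasure N T) :=
        abs_integral_le_integral_abs
      have hstep2 : ∫ z, |(pinnedChain ω₂ lam β γ).bondCurrent N i z * G z| ∂((pinnedChain ω₂ lam β γ).gibbsMeasure N T) ≤
          ∫ z, ((pinnedChain ω₂ lam β γ).bondCurrent N i z ^ 2 + G z ^ 2) ∂((pinnedChain ω₂ lam β γ).gibbsMeasure N T) :=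
        integral_mono_of_nonneg (Eventually.of_forall fun z => abs_nonneg _) hsqi (Eventually.of_forall hdom)
      have hstep3 : ∫ z, ((pinnedChain ω₂ lam β γ).bondCurrent N i z ^ 2 + G z ^ 2) ∂((pinnedChain ω₂ lam β γ).gibbsMeasure N T) =
          (∫ z, (pinnedChain ω₂ lam β γ).bondCurrent N i z ^ 2 ∂((pinnedChain ω₂ lam β γ).gibbsMeasure N T)) +
            ∫ z, G z ^ 2 ∂((pinnedChain ω₂ lam β γ).gibbsMeasure N T) := integral_add hj2i hG2i
      have hsum0 : 0 ≤ (2 + 8 * β) ^ 2 * max Mo2 0 + Cg ^ 2 * max Mog 0 := by positivity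
      linarith
    · -- orthogonality of a far bond: `j_i G e^{-H/T} = -½ p_i G' e^{-H/T} - ½ p_{i+1} G' e^{-H/T}`
      have hdV : deriv (pinnedChain ω₂ lam β γ).V = fun r => r + β * r ^ 3 := funext (pinnedChain_deriv_V ω₂ lam β γ)
      obtain ⟨G', hG'⟩ : ∃ G' : PhaseSpace N → ℝ, ∀ z, G' z =
          deriv (pinnedChain ω₂ lam β γ).V (z.1 ⟨i.val + 1, hi⟩ - z.1 i) * G z := ⟨_, fun _ => rfl⟩
      have hG'c : Continuous G' := by
        rw [show G' = fun z => deriv (pinnedChain ω₂ lam β γ).V (z.1 ⟨i.val + 1, hi⟩ - z.1 i) * G z from funext hG']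
        exact ((show Continuous (deriv (pinnedChain ω₂ lam β γ).V) by rw [hdV]; fun_prop).comp (by fun_prop)).mul hGc
      obtain ⟨KB, hKB⟩ : ∃ KB : ℝ, KB = 1 + ((2 * R + 1 : ℕ) : ℝ) * ((1 + 4 / lam) ^ 2 + 16) := ⟨_, rfl⟩
      have hKB0 : 0 ≤ KB := by rw [hKB]; positivity
      have hGe : ∀ z, |G z| ≤ Cg * KB ^ dg * (1 + (pinnedChain ω₂ lam β γ).hamiltonian N z) ^ (4 * dg) := by
        intro z
        have h := pinnedChain_siteSum_le_energy hω.le hl hβ.le γ sg z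
        rw [← hKB] at h
        have h0 : (0 : ℝ) ≤ 1 + ∑ t : Fin (2 * R + 1), (z.1 (sg t) ^ 2 + z.2 (sg t) ^ 2) :=
          zero_le_one.trans (one_le_siteSum sg z)
        calc |G z| ≤ Cg * (1 + ∑ t : Fin (2 * R + 1), (z.1 (sg t) ^ 2 + z.2 (sg t) ^ 2)) ^ dg := hGb z
          _ ≤ Cg * (KB * (1 + (pinnedChain ω₂ lam β γ).hamiltonian N z) ^ 4) ^ dg :=
              mul_le_mul_of_nonneg_left (pow_le_pow_left₀ h0 h dg) hCg
          _ = _ := by rw [mul_pow, ← pow_mul, mul_assoc]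
      have hG'le : ∀ z, |G' z| ≤ (3 + β) * (Cg * KB ^ dg) * (1 + (pinnedChain ω₂ lam β γ).hamiltonian N z) ^ (4 * dg + 1) := by
        intro z
        have hH0 := pinnedChain_hamiltonian_nonneg hω.le hl.le hβ.le γ N z
        have hV : |deriv (pinnedChain ω₂ lam β γ).V (z.1 ⟨i.val + 1, hi⟩ - z.1 i)| ≤
            (3 + β) * (1 + (pinnedChain ω₂ lam β γ).hamiltonian N z) := by
          have h3 := (pinnedChain_bond_bounds hω.le hl.le hβ.le γ N z (k := i) (l := ⟨i.val + 1, hi⟩) rfl).2.2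
          rw [← sq_abs, ← mul_pow] at h3
          exact (abs_le_of_sq_le_sq' h3 (by positivity)).2
        rw [hG', abs_mul]
        calc |deriv (pinnedChain ω₂ lam β γ).V (z.1 ⟨i.val + 1, hi⟩ - z.1 i)| * |G z|
            ≤ ((3 + β) * (1 + (pinnedChain ω₂ lam β γ).hamiltonian N z)) *
                (Cg * KB ^ dg * (1 + (pinnedChain ω₂ lam β γ).hamiltonian N z) ^ (4 * dg)) :=
              mul_le_mul hV (hGe z) (abs_nonneg _) (by positivity)
          _ = _ := by ring
      have hinv : ∀ k : Fin N, (k.val < x ∨ x + (2 * R + 1) ≤ k.val) →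
          ∀ (z : PhaseSpace N) (t : ℝ), G' (z.1, Function.update z.2 k t) = G' z := by
        intro k hk z t
        rw [hG', hG', hGinv k hk]
      have hki : i.val < x ∨ x + (2 * R + 1) ≤ i.val := by omega
      have hkl : (⟨i.val + 1, hi⟩ : Fin N).val < x ∨ x + (2 * R + 1) ≤ (⟨i.val + 1, hi⟩ : Fin N).val := by
        simp only; omega
      have e1 := pinnedChain_integral_momentum_mul_eq_zero hω hl.le hβ.le γ N hT i hG'c (4 * dg + 1) hG'le (hinv i hki)
      have e2 := pinnedChain_integral_momentum_mul_eq_zero hω hl.le hβ.le γ N hT ⟨i.val + 1, hi⟩ hG'c (4 * dg + 1)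
        hG'le (hinv _ hkl)
      have hsplit : (fun z => (pinnedChain ω₂ lam β γ).bondCurrent N i z * G z * (pinnedChain ω₂ lam β γ).gibbsDensity N T z) =
          fun z => (-1 / 2 : ℝ) * (z.2 i * G' z * (pinnedChain ω₂ lam β γ).gibbsDensity N T z) +
            (-1 / 2 : ℝ) * (z.2 ⟨i.val + 1, hi⟩ * G' z * (pinnedChain ω₂ lam β γ).gibbsDensity N T z) := by
        funext z
        rw [bondCurrent_eq_of_lt _ hi z, hG']
        ring
      have hI : ∀ k : Fin N, Integrable fun z => z.2 k * G' z * (pinnedChain ω₂ lam β γ).gibbsDensity N T z := by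
        intro k
        refine pinnedChain_integrable_mul_gibbsDensity_of_le_pow hω hl.le hβ.le γ N hT (4 * dg + 1 + 2)
          (g := fun z => z.2 k * G' z) ((by fun_prop : Continuous fun z : PhaseSpace N => z.2 k).mul hG'c)
          (C := 4 * ((3 + β) * (Cg * KB ^ dg))) fun z => ?_
        rw [abs_mul]
        have h2 := pinnedChain_abs_momentum_pow_le_pow hω.le hl.le hβ.le γ N z k 1
        rw [pow_one, pow_one, mul_one] at h2
        have hH0 := pinnedChain_hamiltonian_nonneg hω.le hl.le hβ.le γ N z
        calc |z.2 k| * |G' z| ≤ (4 * (1 + (pinnedChain ω₂ lam β γ).hamiltonian N z) ^ 2) *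
              ((3 + β) * (Cg * KB ^ dg) * (1 + (pinnedChain ω₂ lam β γ).hamiltonian N z) ^ (4 * dg + 1)) :=
              mul_le_mul h2 (hG'le z) (abs_nonneg _) (by positivity)
          _ = _ := by ring
      rw [(pinnedChain ω₂ lam β γ).integral_gibbsMeasure, hsplit,
        integral_add ((hI i).const_mul _) ((hI _).const_mul _), integral_const_mul, integral_const_mul, e1, e2]
      simp
  · -- no bond to the right of the last site
    have hj0 : ∀ z, (pinnedChain ω₂ lam β γ).bondCurrent N i z = 0 := fun z => bondCurrent_eq_zero_of_le _ (by omega) z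
    refine ⟨?_, ?_, fun _ => ?_⟩
    · simp only [hj0, zero_mul]
      exact integrable_zero _ _ _
    · simp only [hj0, zero_mul, integral_zero, abs_zero]
      positivity
    · simp only [hj0, zero_mul, integral_zero]

end Pinned

/-! ### §2 The registered stub -/

/-- An elementary bookkeeping inequality: `|A + B + C - W| ≤ |B| + |C|` when `W = A`. [folklore] -/
theorem abs_add_add_sub_le {W A B C : ℝ} (h : W = A) : |A + B + C - W| ≤ |B| + |C| := by
  subst h
  rw [show W + B + C - W = B + C by ring]
  exact abs_add_le _ _

end Summit.AtomisticToContinuum.FouriersLaw.Theorems.OddChargeExists.OverlapDensityLimit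

namespace Summit.AtomisticToContinuum.FouriersLaw.Theorems.OddChargeExists

open Literature.MathematicalPhysics.KineticTheory.HeatConduction OscillatorChain
open Summit.AtomisticToContinuum.FouriersLaw.Theorems.LightConeBondHeat
open Summit.AtomisticToContinuum.FouriersLaw.Theorems.NoOddCharge
open Summit.AtomisticToContinuum.FouriersLaw.Theorems.OddChargeExists.OverlapDensityLimit

/-- **Registered stub `stub_overlapDensityLimit` — THE THERMODYNAMIC LIMIT OF THE CURRENT-OVERLAP DENSITY.**
For the pinned anharmonic chain `pinnedChain ω₂ lam β γ` (all parameters `> 0`), `T > 0`, every window radius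
`R` and every polynomial window density `g` on `2R+1` sites, the overlap density
`N⁻¹ ∫ J_N · Q_N d(volume.tilted (-H_N/T))` (`J_N = Σ_i j_i`, `Q_N = Σ_{x<N-2R} g(sites x..x+2R)`) converges as
`N → ∞`. Proof: momentum orthogonality kills the bonds not touching a window, so `∫ J_N Q_N dμ_{N,T}` is the sum
over bulk anchors of the expectation of the fixed `(2R+3)`-site polynomial observable `F = (Σ_c j_c)·g` plus two
boundary windows bounded uniformly in `N` (`N`-uniform one-site moments); the Cesàro sum of the bulk
expectations converges by the anchor-uniform bulk equivalence of ensembles for bounded truncations of `F`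
(`stub_bulkWindowEquivalence`) with `N`-uniform truncation errors, and completeness of `ℝ`. -/
theorem stub_overlapDensityLimit : ∀ ω₂ lam β γ T : ℝ, 0 < ω₂ → 0 < lam → 0 < β → 0 < γ → 0 < T → ∀ P : Literature.MathematicalPhysics.KineticTheory.HeatConduction.OscillatorChain, P = Literature.MathematicalPhysics.KineticTheory.HeatConduction.pinnedChain ω₂ lam β γ → ∀ (R : ℕ) (g : (Fin (2 * R + 1) → ℝ × ℝ) → ℝ), (∃ p : MvPolynomial (Fin (2 * R + 1) ⊕ Fin (2 * R + 1)) ℝ, ∀ y : Fin (2 * R + 1) → ℝ × ℝ, g y = MvPolynomial.eval (Sum.elim (fun i => (y i).1) (fun i => (y i).2)) p) → ∃ χ : ℝ, Filter.Tendsto (fun N : ℕ => (∫ z, (∑ i : Fin N, P.bondCurrent N i z) * (∑ x ∈ Finset.range (N - 2 * R), g (fun i => if h : x + i.val < N then (z.1 ⟨x + i.val, h⟩, z.2 ⟨x + i.val, h⟩) else (0, 0))) ∂(MeasureTheory.volume.tilted fun x => -P.hamiltonian N x / T)) / (N : ℝ)) Filter.atTop (nhds χ) := by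
  intro ω₂ lam β γ T hω hl hβ hγ hT P hP R g hg
  subst hP
  obtain ⟨Cg, hCg, dg, hgb⟩ := growth_of_poly hg
  have hgc : Continuous g := continuous_of_poly hg
  obtain ⟨C₁, hC₁0, hC₁⟩ := pinnedChain_current_obs_term hω hl hβ γ hT R hCg dg
  -- facts on the current–window terms `∫ j_i g_x dμ_{N,T}`
  have hT3 : ∀ (N : ℕ) (i : Fin N) (x : ℕ), x + 2 * R < N →
      Integrable (fun z : PhaseSpace N => (pinnedChain ω₂ lam β γ).bondCurrent N i z *
          g (fun t : Fin (2 * R + 1) => if h : x + t.val < N then (z.1 ⟨x + t.val, h⟩, z.2 ⟨x + t.val, h⟩) else (0, 0)))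
        ((pinnedChain ω₂ lam β γ).gibbsMeasure N T) ∧
      |∫ z, (pinnedChain ω₂ lam β γ).bondCurrent N i z *
          g (fun t : Fin (2 * R + 1) => if h : x + t.val < N then (z.1 ⟨x + t.val, h⟩, z.2 ⟨x + t.val, h⟩) else (0, 0))
        ∂((pinnedChain ω₂ lam β γ).gibbsMeasure N T)| ≤ C₁ ∧
      ((i.val + 1 < x ∨ x + 2 * R < i.val) →
        ∫ z, (pinnedChain ω₂ lam β γ).bondCurrent N i z *
          g (fun t : Fin (2 * R + 1) => if h : x + t.val < N then (z.1 ⟨x + t.val, h⟩, z.2 ⟨x + t.val, h⟩) else (0, 0))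
        ∂((pinnedChain ω₂ lam β γ).gibbsMeasure N T) = 0) :=
    fun N i x hx => hC₁ N i x (fun t => ⟨x + t.val, by omega⟩) _ (continuous_windowObs x hgc)
      (fun z => abs_windowObs_le x (by omega) hgb z) (fun k hk z t => windowObs_update_snd x z k hk t)
  -- the window observable `F = (Σ_c j_c) · g` on `2R+3` sites: continuity and polynomial growth
  have hFc : Continuous fun w : PhaseSpace (2 * R + 2 + 1) =>
      (∑ c : Fin (2 * R + 2), (pinnedChain ω₂ lam β γ).bondCurrent (2 * R + 2 + 1) ⟨c.val, by omega⟩ w) *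
        g (fun t : Fin (2 * R + 1) => (w.1 ⟨t.val + 1, by omega⟩, w.2 ⟨t.val + 1, by omega⟩)) := by
    refine (continuous_finsetSum _ fun c _ => pinnedChain_continuous_bondCurrent ω₂ lam β γ _ _).mul ?_
    exact hgc.comp (continuous_pi fun t => by fun_prop)
  have hFb : ∀ w : PhaseSpace (2 * R + 2 + 1),
      |(∑ c : Fin (2 * R + 2), (pinnedChain ω₂ lam β γ).bondCurrent (2 * R + 2 + 1) ⟨c.val, by omega⟩ w) *
        g (fun t : Fin (2 * R + 1) => (w.1 ⟨t.val + 1, by omega⟩, w.2 ⟨t.val + 1, by omega⟩))| ≤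
      (((2 * R + 2 : ℕ) : ℝ) * (2 + 8 * β) * Cg) * (1 + ∑ j : Fin (2 * R + 2 + 1), (w.1 j ^ 2 + w.2 j ^ 2)) ^ (dg + 4) := by
    intro w
    have hB1 : (1 : ℝ) ≤ 1 + ∑ j : Fin (2 * R + 2 + 1), (w.1 j ^ 2 + w.2 j ^ 2) := one_le_siteSum (fun j => j) w
    have hB0 : (0 : ℝ) ≤ 1 + ∑ j : Fin (2 * R + 2 + 1), (w.1 j ^ 2 + w.2 j ^ 2) := zero_le_one.trans hB1
    have hq : ∀ j, |w.1 j| ≤ 1 + ∑ j : Fin (2 * R + 2 + 1), (w.1 j ^ 2 + w.2 j ^ 2) :=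
      fun j => abs_fst_le_siteSum (fun j => j) w j
    have hp : ∀ j, |w.2 j| ≤ 1 + ∑ j : Fin (2 * R + 2 + 1), (w.1 j ^ 2 + w.2 j ^ 2) :=
      fun j => abs_snd_le_siteSum (fun j => j) w j
    have hgw : |g (fun t : Fin (2 * R + 1) => (w.1 ⟨t.val + 1, by omega⟩, w.2 ⟨t.val + 1, by omega⟩))| ≤
        Cg * (1 + ∑ j : Fin (2 * R + 2 + 1), (w.1 j ^ 2 + w.2 j ^ 2)) ^ dg :=
      hgb _ _ hB1 (fun t => hq _) (fun t => hp _)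
    have hjw : ∀ c : Fin (2 * R + 2), |(pinnedChain ω₂ lam β γ).bondCurrent (2 * R + 2 + 1) ⟨c.val, by omega⟩ w| ≤
        (2 + 8 * β) * (1 + ∑ j : Fin (2 * R + 2 + 1), (w.1 j ^ 2 + w.2 j ^ 2)) ^ 4 := by
      intro c
      have h := pinnedChain_abs_bondCurrent_le_siteSum hβ.le ω₂ lam γ (⟨c.val, by omega⟩ : Fin (2 * R + 2 + 1))
        (by simp only; omega) w
      refine h.trans (mul_le_mul_of_nonneg_left (pow_le_pow_left₀ ?_ (pair_siteSum_le w ?_) 4) (by positivity))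
      · exact zero_le_one.trans (one_le_siteSum _ w)
      · intro e
        have h' := congrArg Fin.val e
        simp only at h'
        omega
    have hjsum : |∑ c : Fin (2 * R + 2), (pinnedChain ω₂ lam β γ).bondCurrent (2 * R + 2 + 1) ⟨c.val, by omega⟩ w| ≤
        ((2 * R + 2 : ℕ) : ℝ) * ((2 + 8 * β) * (1 + ∑ j : Fin (2 * R + 2 + 1), (w.1 j ^ 2 + w.2 j ^ 2)) ^ 4) := by
      refine (Finset.abs_sum_le_sum_abs _ _).trans ((Finset.sum_le_sum fun c _ => hjw c).trans ?_)
      rw [Finset.sum_const, Finset.card_univ, Fintype.card_fin, nsmul_eq_mul]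
    rw [abs_mul]
    calc _ ≤ (((2 * R + 2 : ℕ) : ℝ) * ((2 + 8 * β) * (1 + ∑ j : Fin (2 * R + 2 + 1), (w.1 j ^ 2 + w.2 j ^ 2)) ^ 4)) *
          (Cg * (1 + ∑ j : Fin (2 * R + 2 + 1), (w.1 j ^ 2 + w.2 j ^ 2)) ^ dg) :=
          mul_le_mul hjsum hgw (abs_nonneg _) (by positivity)
      _ = _ := by ring
  have hCF : (0 : ℝ) ≤ ((2 * R + 2 : ℕ) : ℝ) * (2 + 8 * β) * Cg := by positivity
  refine tendsto_div_of_windowSum hω hl hβ hγ hT (2 * R + 2) hFc hCF (dg + 4) hFb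
    (D := 2 * (((2 * R + 2 : ℕ) : ℝ) * C₁)) (N₁ := 2 * R + 3) fun N hN => ?_
  -- bookkeeping at a fixed `N ≥ 2R + 3`
  obtain ⟨c, hc⟩ : ∃ c : Fin N → ℕ → ℝ, ∀ i x, c i x = ∫ z, (pinnedChain ω₂ lam β γ).bondCurrent N i z *
      g (fun t : Fin (2 * R + 1) => if h : x + t.val < N then (z.1 ⟨x + t.val, h⟩, z.2 ⟨x + t.val, h⟩) else (0, 0))
      ∂((pinnedChain ω₂ lam β γ).gibbsMeasure N T) := ⟨_, fun _ _ => rfl⟩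
  have hxN : ∀ x ∈ Finset.range (N - 2 * R), x + 2 * R < N := fun x hx => by
    rw [Finset.mem_range] at hx; omega
  -- (1) `∫ J_N Q_N dμ = Σ_x Σ_i c i x`
  have ha1 : (∫ z, (∑ i : Fin N, (pinnedChain ω₂ lam β γ).bondCurrent N i z) *
      (∑ x ∈ Finset.range (N - 2 * R), g (fun i => if h : x + i.val < N then (z.1 ⟨x + i.val, h⟩, z.2 ⟨x + i.val, h⟩)
        else (0, 0))) ∂((volume : Measure (PhaseSpace N)).tilted fun x => -(pinnedChain ω₂ lam β γ).hamiltonian N x / T)) =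
      ∑ x ∈ Finset.range (N - 2 * R), ∑ i : Fin N, c i x := by
    rw [← OscillatorChain.gibbsMeasure_eq]
    have e1 : ∀ z : PhaseSpace N, (∑ i : Fin N, (pinnedChain ω₂ lam β γ).bondCurrent N i z) *
        (∑ x ∈ Finset.range (N - 2 * R), g (fun i => if h : x + i.val < N then (z.1 ⟨x + i.val, h⟩, z.2 ⟨x + i.val, h⟩)
          else (0, 0))) =
        ∑ x ∈ Finset.range (N - 2 * R), ∑ i : Fin N, (pinnedChain ω₂ lam β γ).bondCurrent N i z *
          g (fun i => if h : x + i.val < N then (z.1 ⟨x + i.val, h⟩, z.2 ⟨x + i.val, h⟩) else (0, 0)) := by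
      intro z
      rw [Finset.sum_mul_sum, Finset.sum_comm]
    simp only [hc]
    rw [integral_congr_ae (Eventually.of_forall e1),
      integral_finsetSum _ (fun x hx => integrable_finsetSum _ fun i _ => (hT3 N i x (hxN x hx)).1)]
    exact Finset.sum_congr rfl fun x hx => integral_finsetSum _ fun i _ => (hT3 N i x (hxN x hx)).1
  -- (2) boundary windows: at most `2R+2` touching bonds, each term bounded by `C₁`
  have hbd : ∀ x, x + 2 * R < N → |∑ i : Fin N, c i x| ≤ ((2 * R + 2 : ℕ) : ℝ) * C₁ := by
    intro x hx
    have hle : ∀ i : Fin N, |c i x| ≤ if x ≤ i.val + 1 ∧ i.val ≤ x + 2 * R then C₁ else 0 := by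
      intro i
      split_ifs with ht
      · rw [hc]; exact (hT3 N i x hx).2.1
      · rw [hc, (hT3 N i x hx).2.2 (by omega), abs_zero]
    have hcard : (((Finset.univ : Finset (Fin N)).filter (fun i : Fin N => x ≤ i.val + 1 ∧ i.val ≤ x + 2 * R)).card : ℝ) ≤
        ((2 * R + 2 : ℕ) : ℝ) := by
      have h1 : ((Finset.univ : Finset (Fin N)).filter (fun i : Fin N => x ≤ i.val + 1 ∧ i.val ≤ x + 2 * R)).card ≤
          (Finset.Icc (x - 1) (x + 2 * R)).card := by
        refine Finset.card_le_card_of_injOn (fun i => i.val) (fun i hi => ?_) (fun i _ i' _ h => Fin.ext h)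
        simp only [Finset.coe_filter, Finset.mem_univ, true_and, Set.mem_setOf_eq] at hi
        simp only [Finset.coe_Icc, Set.mem_Icc]
        omega
      rw [Nat.card_Icc] at h1
      have h2 : x + 2 * R + 1 - (x - 1) ≤ 2 * R + 2 := by omega
      exact_mod_cast h1.trans h2
    calc |∑ i : Fin N, c i x| ≤ ∑ i : Fin N, |c i x| := Finset.abs_sum_le_sum_abs _ _
      _ ≤ ∑ i : Fin N, (if x ≤ i.val + 1 ∧ i.val ≤ x + 2 * R then C₁ else 0) := Finset.sum_le_sum fun i _ => hle i
      _ = (((Finset.univ : Finset (Fin N)).filter (fun i : Fin N => x ≤ i.val + 1 ∧ i.val ≤ x + 2 * R)).card : ℝ) * C₁ := by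
          rw [Finset.sum_ite, Finset.sum_const_zero, add_zero, Finset.sum_const, nsmul_eq_mul]
      _ ≤ ((2 * R + 2 : ℕ) : ℝ) * C₁ := mul_le_mul_of_nonneg_right hcard hC₁0
  -- (3) bulk windows: the touching bonds assemble to `F` read at the anchor `a`
  have hmid : ∀ (a : ℕ) (ha : a + (2 * R + 2) < N), ∑ i : Fin N, c i (a + 1) =
      ∫ z, (∑ c' : Fin (2 * R + 2), (pinnedChain ω₂ lam β γ).bondCurrent (2 * R + 2 + 1) ⟨c'.val, by omega⟩
          ((fun j : Fin (2 * R + 2 + 1) => z.1 ⟨a + j.val, by omega⟩),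
            fun j : Fin (2 * R + 2 + 1) => z.2 ⟨a + j.val, by omega⟩)) *
        g (fun t : Fin (2 * R + 1) => (z.1 ⟨a + (t.val + 1), by omega⟩, z.2 ⟨a + (t.val + 1), by omega⟩))
        ∂((pinnedChain ω₂ lam β γ).gibbsMeasure N T) := by
    intro a ha
    simp only [hc]
    exact window_sum_eq (pinnedChain ω₂ lam β γ) _ g a ha (fun i => (hT3 N i (a + 1) (by omega)).1)
      (fun i hi => (hT3 N i (a + 1) (by omega)).2.2 hi)
  -- (4) assemble: `∫ J_N Q_N dμ - Σ_{bulk} = (window x = 0) + (window x = N-2R-1)`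
  rw [ha1, show N - 2 * R = N - 2 * R - 2 + 1 + 1 by omega, Finset.sum_range_succ, Finset.sum_range_succ']
  refine (abs_add_add_sub_le ?_).trans ?_
  · refine Finset.sum_congr ?_ fun a ha => ?_
    · exact congrArg Finset.range (by omega)
    · rw [Finset.mem_range] at ha
      rw [dif_pos (by omega)]
      exact (hmid a (by omega)).symm
  · have hb0 := hbd 0 (by omega)
    have hb1 := hbd (N - 2 * R - 2 + 1) (by omega)
    calc |∑ i : Fin N, c i 0| + |∑ i : Fin N, c i (N - 2 * R - 2 + 1)|
        ≤ ((2 * R + 2 : ℕ) : ℝ) * C₁ + ((2 * R + 2 : ℕ) : ℝ) * C₁ := add_le_add hb0 hb1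
      _ = 2 * (((2 * R + 2 : ℕ) : ℝ) * C₁) := by ring

end Summit.AtomisticToContinuum.FouriersLaw.Theorems.OddChargeExists

end
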